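import Literature.NumberTheory.Sieve.GoldbachLinnikDirectProfile
import Literature.NumberTheory.Sieve.GoldbachLinnikRomanovDischarge
import HarnessLib

/-!
# The crude mean square `∫₀¹ |A_N G_L|² ≪ N L²` (Linnik–Gallagher; Heath-Brown–Puchta §5), PROVED

Topic `Literature/NumberTheory/Sieve`, namespace `Literature.NumberTheory.Sieve.GoldbachLinnik`
(continuation of `GoldbachLinnikDirectProfile.lean`, `GoldbachLinnikRomanovDischarge.lean`).

With `A_N(α) = ∑_{2<p≤N} (log p) e(pα)` (`oddPrimeLogSum`) and `G_L(α) = ∑_{1≤ν≤L} e(2^ν α)`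
(`powSumL`), the whole-circle mean square is a sum of shifted prime-pair counts,
`J = ∫₀¹ |A_N G_L|² = ∑_{μ,ν ≤ L} r_{log}(2^μ − 2^ν)` [HeathbrownPuchta2002, §5, «J = ∑_{μ,ν≤L}
r(2^μ − 2^ν)»], each `r(n) ≪ 𝔖(n) N/log²N` by the upper-bound sieve and `∑_{μ,ν} 𝔖(2^μ − 2^ν) ≪ L²`
by Romanov's lemma, so `J ≪ N L²` — the bound every proof of Linnik's theorem uses ([ibid., §5: «it was
shown by Li … that J ≤ (24.95 + o(1)) C₀ N/log² 2»]; [PintzRuzsa2003, §8 Lemma 10]).  Here, from the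
tree's PROVED `setIntegral_normSq_weighted_mul_powSumL_eq` (orthogonality),
`weightedPairIntegral_univ_log_le` and `exists_eventually_sum_pairCount_le` (sieve + Romanov), at
Pintz–Ruzsa's length `L = prLen N`:

  `meanSquareCrude : ∃ C > 0, ∀ ε > 0, ∀ᶠ N, ∫_{[0,1]} |A_N G_{prLen N}|² ≤ (C + ε) · 2N (prLen N)²`

— VERBATIM the support item «MeanSquareCrude» of the parity-ideate route `LinnikGallagherMV` (no value
of `C` claimed).  No new facts.  Written for the parity-ideate cell (route `LinnikGallagherMV`, item
stmt-Parity-20514; literature seat g15, 2026-08-27).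

## References

* [HeathbrownPuchta2002] D. R. Heath-Brown, J.-C. Puchta, *Integers represented as a sum of primes and
  powers of two*, Asian J. Math. 6 (2002) (arXiv:math/0201299), §5 (the mean square `J`, its
  expansion `J = ∑ r(2^μ − 2^ν)` and the bound `J ≪ N`; render p0008 L1–L40).
* [PintzRuzsa2003] J. Pintz, I. Z. Ruzsa, *On Linnik's approximation to Goldbach's problem, I*,
  Acta Arith. 109 (2003), §8 Lemma 10.

## Mathlib / tree search

Tree: `oddPrimeLogSum_eq_weightedPrimeSum`, `setIntegral_normSq_weighted_mul_powSumL_eq`,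
`weightedPairIntegral_univ_log_le`, `expPairs_eq_expPairsL`, `prLen_le_powLen`,
`eventually_powLen_le_mul_prLen` (`GoldbachLinnikDirectProfile`); `exists_eventually_sum_pairCount_le`
(`GoldbachLinnikRomanovDischarge`). `lean search 'meanSquareCrude'`: nothing before this file.
-/

noncomputable section

open Finset Filter MeasureTheory

namespace Literature.NumberTheory.Sieve

namespace GoldbachLinnik

/-- **The crude whole-circle mean square** — VERBATIM the support item «MeanSquareCrude» of the
parity-ideate route `LinnikGallagherMV`: there is `C > 0` such that for every `ε > 0`,
`∫_{[0,1]} |A_N(α) G_{L}(α)|² dα ≤ (C + ε) · 2N L²` for all large `N`, `L = prLen N`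
(orthogonality: the integral is `∑_{μ,ν≤L} ∑_{p′−p = 2^μ−2^ν} log p log p′ ≤ log²N ∑ r(2^μ−2^ν)`;
upper-bound sieve + Romanov: `∑ r ≪ N L²/log²N`).
[cite: HeathbrownPuchta2002, §5 (J = ∑_{μ,ν≤L} r(2^μ − 2^ν), J ≪ N); PintzRuzsa2003, §8 Lemma 10] -/
theorem meanSquareCrude :
    ∃ C : ℝ, 0 < C ∧ ∀ ε : ℝ, 0 < ε → ∀ᶠ N : ℕ in atTop,
      ∫ α in Set.Icc (0 : ℝ) 1,
          ‖Literature.NumberTheory.Sieve.GoldbachLinnik.oddPrimeLogSum N α *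
              Literature.NumberTheory.Sieve.GoldbachLinnik.powSumL
                (Literature.NumberTheory.Sieve.GoldbachLinnik.prLen N) α‖ ^ 2 ≤
        (C + ε) * (2 * N * (Literature.NumberTheory.Sieve.GoldbachLinnik.prLen N : ℝ) ^ 2) := by
  obtain ⟨C_T, hT⟩ := exists_eventually_sum_pairCount_le
  refine ⟨max C_T 0 + 1, by positivity, fun ε hε => ?_⟩
  filter_upwards [hT, eventually_powLen_le_mul_prLen (2 / 5) (by norm_num), eventually_ge_atTop 2]
    with N hTN hLN hN2
  set L : ℕ := prLen N with hL
  have hN0 : (0 : ℝ) < N := by exact_mod_cast (show 0 < N by omega)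
  have hlog : 0 < Real.log N := Real.log_pos (by exact_mod_cast (show 1 < N by omega))
  have hL0 : (0 : ℝ) ≤ L := Nat.cast_nonneg _
  -- Step 1: orthogonality, `∫ |A G|² = ∑_{pairs} (log-weighted pair integral)`
  have hexp : ∫ α in Set.Icc (0 : ℝ) 1, ‖oddPrimeLogSum N α * powSumL L α‖ ^ 2 =
      ∑ z ∈ expPairsL L, weightedPairIntegral Set.univ (fun p : ℕ => Real.log (p : ℝ))
        (fun p : ℕ => Real.log (p : ℝ)) N (pairShift z) := by
    rw [← setIntegral_normSq_weighted_mul_powSumL_eq, Set.inter_univ]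
    refine integral_congr_ae (Eventually.of_forall fun α => ?_)
    simp only [oddPrimeLogSum_eq_weightedPrimeSum, norm_mul, mul_pow]
  -- Step 2: each pair integral ≤ log²N · (pair count); enlarge `L ≤ powLen N`
  have hsub : expPairsL L ⊆ expPairs N := by
    rw [expPairs_eq_expPairsL]
    exact product_subset_product (Icc_subset_Icc_right (prLen_le_powLen N))
      (Icc_subset_Icc_right (prLen_le_powLen N))
  have hsum : ∑ z ∈ expPairsL L, weightedPairIntegral Set.univ (fun p : ℕ => Real.log (p : ℝ))
        (fun p : ℕ => Real.log (p : ℝ)) N (pairShift z) ≤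
      Real.log N ^ 2 * ∑ z ∈ expPairs N, (pairCount N (pairShift z) : ℝ) := by
    calc ∑ z ∈ expPairsL L, weightedPairIntegral Set.univ (fun p : ℕ => Real.log (p : ℝ))
          (fun p : ℕ => Real.log (p : ℝ)) N (pairShift z)
        ≤ ∑ z ∈ expPairsL L, Real.log N ^ 2 * (pairCount N (pairShift z) : ℝ) :=
          sum_le_sum fun z _ => weightedPairIntegral_univ_log_le N _
      _ ≤ ∑ z ∈ expPairs N, Real.log N ^ 2 * (pairCount N (pairShift z) : ℝ) :=
          sum_le_sum_of_subset_of_nonneg hsub fun z _ _ => by positivity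
      _ = Real.log N ^ 2 * ∑ z ∈ expPairs N, (pairCount N (pairShift z) : ℝ) := by
          rw [mul_sum]
  -- Step 3: sieve + Romanov, `∑ pairCount ≤ C_T N powLen²/log²N ≤ (max C_T 0)(1.4 L)² N/log²N`
  have hpow : (powLen N : ℝ) ^ 2 ≤ (1 + 2 / 5) ^ 2 * (L : ℝ) ^ 2 := by
    rw [← mul_pow]
    exact pow_le_pow_left₀ (Nat.cast_nonneg _) hLN 2
  have hC0 : C_T ≤ max C_T 0 := le_max_left _ _
  have hT' : (∑ z ∈ expPairs N, (pairCount N (pairShift z) : ℝ)) ≤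
      max C_T 0 * (N * ((1 + 2 / 5) ^ 2 * (L : ℝ) ^ 2) / Real.log N ^ 2) := by
    refine hTN.trans ?_
    have h1 : C_T * (N * (powLen N : ℝ) ^ 2 / Real.log N ^ 2) ≤
        max C_T 0 * (N * (powLen N : ℝ) ^ 2 / Real.log N ^ 2) :=
      mul_le_mul_of_nonneg_right hC0 (by positivity)
    refine h1.trans (mul_le_mul_of_nonneg_left ?_ (le_max_right _ _))
    gcongr
  -- Step 4: assemble
  rw [hexp]
  refine hsum.trans ?_
  have hlog2 : Real.log N ^ 2 ≠ 0 := by positivity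
  calc Real.log N ^ 2 * ∑ z ∈ expPairs N, (pairCount N (pairShift z) : ℝ)
      ≤ Real.log N ^ 2 * (max C_T 0 * (N * ((1 + 2 / 5) ^ 2 * (L : ℝ) ^ 2) / Real.log N ^ 2)) :=
        mul_le_mul_of_nonneg_left hT' (by positivity)
    _ = max C_T 0 * (1 + 2 / 5) ^ 2 / 2 * (2 * N * (L : ℝ) ^ 2) := by
        field_simp
    _ ≤ (max C_T 0 + 1 + ε) * (2 * N * (L : ℝ) ^ 2) := by
        refine mul_le_mul_of_nonneg_right ?_ (by positivity)
        have hm : 0 ≤ max C_T 0 := le_max_right _ _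
        nlinarith

end GoldbachLinnik

end Literature.NumberTheory.Sieve

end
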